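import Mathlib
import Summits.Ventures.PercRepro2.HCov
import Summits.Ventures.PercRepro2.BHKAvoid
import Summits.Ventures.PercRepro2.ExploreA3
import Summits.Ventures.PercRepro2.RootLeafUSigns
import Summits.Ventures.PercRepro2.RootLeafUHalf
import Summits.Ventures.PercRepro2.RootLeafUCore
import Summits.Ventures.PercRepro2.RootLeafUYA
import Summits.Ventures.PercRepro2.RootLeafUSepIndep
import Summits.Ventures.PercRepro2.RootLeafUSepK
import Summits.Ventures.PercRepro2.RootLeafUSepB

/-!
# (G4-u) on the class «`u` separates the root `a₂` from `b`», part 1: the `b`-side facts and the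
`o ∈ L` half (a theorem) (blind cell PercRepro2, p4 g8; S3 (G4-u), proofs/P4-G8-SEP.md §9–§10)
The class is **`∀ ω, Conn ω a₂ b → Conn ω a₂ u`** (every open `a₂–b` connection passes through `u`);
`pb = P(u ↔ b)`.  Then `b ∉ K` on `Q`, and `{u ↔ b}` is independent of the cluster of `a₂` under `Q`
(`RootLeafUSepK` with `b` in the role of `c`): `hb = (1 − Z) pb`, `P(Q, bL) = pb Z`, `P(T, bL) = pb t`.
* `T2oL = 2pb[(2 − Z)(D + t′) − Z d0]·P(PD,oL) + 2pb[D(1 − Z) − d0 Z]·P(T,oL) + 2(D + d0 Z)·P(T,oL,bL)`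
  (`SepUB.T2oL_sepUB_eq`) and **`0 ≤ T2oL`** (`SepUB.T2oL_nonneg_of_sepUB`: Harris `d0 Z ≤ D + t′`,
  the residual Harris bound `P(T,oL,bL) ≥ pb·P(T,oL)` in `G ∖ C(a₂)`);
* `T2oK = 2pb·{2(1 − Z)·[t′ P(PD,oK) − D P(T′,oK)] + Z·[D η_o − η P(PD,oK)]}` (`SepUB.T2oK_sepUB_eq`;
  `η = P(a₂ ↔ u, a₂ ↮ c)`, `η_o = P(a₂ ↔ u, a₂ ↔ o, a₂ ↮ c)`), the first bracket `≥ 0` by BHK06 Thm 1.4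
  with the avoided set `{u, c}` (`bhk_cross_cluster_avoid`), so **`0 ≤ T2oK` modulo (SW2)**
  `η·P(PD,oK) ≤ D·η_o` (`SepUB.T2oK_nonneg_of_sepUB`, census 0 / 850 on general instances);
* **`SepUB.HCov_root_leaf_u_of_sepUB`**: (G4-u) on the class, conditional on (SW2) for the instance.
-/

namespace Summit.Ventures.PercRepro2

open UnionCluster CovForm

namespace RootLeafU

namespace SepUB

section SepUB

variable {V : Type*} {E : Type*} [Fintype E] [DecidableEq E] [Fintype V] [DecidableEq V]
  {R : Type*} [Field R] [LinearOrder R] [IsStrictOrderedRing R]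

variable (p : E → R) (ends : E → Sym2 V) (o a₂ c b u : V)

omit [Fintype E] [DecidableEq E] [Fintype V] [DecidableEq V] in
/-- On the class, `b ∉ K` on `Q`: `Q ∩ {a₂ ↔ b} = ∅`. -/
lemma Q_inter_bK_eq_empty (hsep : ∀ ω : Config E, Conn ends ω a₂ b → Conn ends ω a₂ u) :
    avoidAll ends a₂ {u} ∩ connEvent ends a₂ b = ∅ := by
  ext ω
  simp only [Set.mem_inter_iff, mem_connEvent, Set.mem_empty_iff_false, iff_false, not_and]
  intro hQ hb
  exact hQ u (Finset.mem_singleton_self u) (hsep ω hb)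

omit [Fintype V] [DecidableEq V] [LinearOrder R] [IsStrictOrderedRing R] in
/-- Any event inside `Q ∩ {a₂ ↔ b}` is null on the class. -/
lemma prob_eq_zero_of_subset (hsep : ∀ ω : Config E, Conn ends ω a₂ b → Conn ends ω a₂ u)
    {A : Set (Config E)} (hA : A ⊆ avoidAll ends a₂ {u} ∩ connEvent ends a₂ b) : prob p A = 0 := by
  have : A = ∅ := Set.subset_eq_empty hA (Q_inter_bK_eq_empty ends a₂ b u hsep)
  rw [this, prob_empty]

omit [DecidableEq V] in
/-- `hb = P(a₂ ↔ b) = pb · (1 − Z)` on the class. -/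
lemma hb_eq (hsep : ∀ ω : Config E, Conn ends ω a₂ b → Conn ends ω a₂ u) (hua : u ≠ a₂) :
    prob p (connEvent ends a₂ b) =
      prob p (connEvent ends u b) * (1 - prob p (avoidAll ends a₂ {u})) := by
  have h := SepK.d0_eq p ends a₂ b u hsep hua
  rw [avoidAll_singleton_eq ends a₂ b, prob_compl] at h
  linear_combination -h

omit [DecidableEq V] [LinearOrder R] [IsStrictOrderedRing R] in
/-- `P(Q, bL) = pb · Z`. -/
lemma prob_Q_bL_eq (hsep : ∀ ω : Config E, Conn ends ω a₂ b → Conn ends ω a₂ u) (hua : u ≠ a₂) :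
    prob p (avoidAll ends a₂ {u} ∩ connEvent ends u b) =
      prob p (connEvent ends u b) * prob p (avoidAll ends a₂ {u}) := by
  have h := SepK.prob_Q_clusterInK_conn_eq p ends a₂ b u hsep hua Set.univ
  rwa [clusterInEvent_univ, Set.inter_univ] at h

omit [DecidableEq V] [LinearOrder R] [IsStrictOrderedRing R] in
/-- `P(T, bL) = pb · t` (`T = Q ∩ {c ∈ K}` is a `K`-event). -/
lemma prob_T_bL_eq (hsep : ∀ ω : Config E, Conn ends ω a₂ b → Conn ends ω a₂ u) (hua : u ≠ a₂) :
    prob p (TEvent ends u a₂ c ∩ connEvent ends u b) =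
      prob p (connEvent ends u b) * prob p (TEvent ends u a₂ c) := by
  have h := SepK.prob_Q_clusterInK_conn_eq p ends a₂ b u hsep hua {W | c ∈ W}
  rw [ExploreA3.clusterInEvent_mem_eq, ← Sep.TEvent_eq ends a₂ c u] at h
  exact h

omit [DecidableEq V] in
/-- `P(T, oL, bL) ≥ pb · P(T, oL)`: in the residual graph `G ∖ C(a₂)` the events `u ↔ o` and
`u ↔ b` are positively correlated, and `P(u ↔ b in G ∖ C(a₂)) = pb` (del-invariance). -/
lemma prob_T_oL_bL_ge (hp : IsProbVec p)
    (hsep : ∀ ω : Config E, Conn ends ω a₂ b → Conn ends ω a₂ u) (hua : u ≠ a₂) :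
    prob p (connEvent ends u b) * prob p (TEvent ends u a₂ c ∩ connEvent ends u o) ≤
      prob p (TEvent ends u a₂ c ∩ (connEvent ends u o ∩ connEvent ends u b)) := by
  classical
  have hu : u ∈ ({u} : Finset V) := by simp
  have tOB := prob_clusterIn_inter_avoid_eq_expect p ends a₂ u hu {W | c ∈ W} ({W | o ∈ W} ∩ {W | b ∈ W})
  have tO := prob_clusterIn_inter_avoid_eq_expect p ends a₂ u hu {W | c ∈ W} {W | o ∈ W}
  rw [clusterInEvent_mem_inter_eq] at tOB
  rw [ExploreA3.clusterInEvent_mem_eq ends u o] at tO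
  have e1 : clusterInEvent ends a₂ {W | c ∈ W} ∩ (connEvent ends u o ∩ connEvent ends u b) ∩
      avoidAll ends a₂ {u} = TEvent ends u a₂ c ∩ (connEvent ends u o ∩ connEvent ends u b) := by
    rw [Sep.TEvent_eq ends a₂ c u, ExploreA3.clusterInEvent_mem_eq]
    ext ω
    simp only [Set.mem_inter_iff]
    tauto
  have e2 : clusterInEvent ends a₂ {W | c ∈ W} ∩ connEvent ends u o ∩ avoidAll ends a₂ {u} =
      TEvent ends u a₂ c ∩ connEvent ends u o := by
    rw [Sep.TEvent_eq ends a₂ c u, ExploreA3.clusterInEvent_mem_eq]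
    ext ω
    simp only [Set.mem_inter_iff]
    tauto
  rw [e1] at tOB
  rw [e2] at tO
  rw [tOB, tO, ← expect_const_mul]
  refine expect_mono hp fun ω => ?_
  by_cases hω : ω ∈ avoidAll ends a₂ {u}
  · have h₀ : ¬ Conn ends ω a₂ u := hω u (Finset.mem_singleton_self u)
    have hb' : prob p {ω' | Conn ends (delConfig ends (cluster ends ω a₂) ω') u b} =
        prob p (connEvent ends u b) := by
      congr 1
      ext ω'
      simp only [Set.mem_setOf_eq, mem_connEvent]
      exact Sep.conn_delConfig_iff hsep (Ne.symm hua) h₀ ω'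
    have hup : ∀ x : V, IsUpperSet {ω' : Config E | Conn ends (delConfig ends (cluster ends ω a₂) ω') u x} :=
      fun x ω₁ ω₂ h hω₁ => conn_mono (Sep.delConfig_mono _ h) hω₁
    have key := prob_mul_prob_le_prob_inter hp (hup o) (hup b)
    rw [hb'] at key
    have hOB : delClusterProb p ends u ({W | o ∈ W} ∩ {W | b ∈ W}) (cluster ends ω a₂) =
        prob p ({ω' | Conn ends (delConfig ends (cluster ends ω a₂) ω') u o} ∩
          {ω' | Conn ends (delConfig ends (cluster ends ω a₂) ω') u b}) := by
      unfold delClusterProb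
      congr 1
    have hO : delClusterProb p ends u {W | o ∈ W} (cluster ends ω a₂) =
        prob p {ω' | Conn ends (delConfig ends (cluster ends ω a₂) ω') u o} := by
      unfold delClusterProb
      congr 1
    rw [hOB, hO]
    have h2 : (0 : R) ≤ ({W : Set V | c ∈ W}).indicator 1 (cluster ends ω a₂) :=
      Set.indicator_apply_nonneg fun _ => zero_le_one
    have h3 : (0 : R) ≤ (avoidAll ends a₂ {u}).indicator 1 ω :=
      Set.indicator_apply_nonneg fun _ => zero_le_one
    calc prob p (connEvent ends u b) * (({W : Set V | c ∈ W}).indicator 1 (cluster ends ω a₂) *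
          prob p {ω' | Conn ends (delConfig ends (cluster ends ω a₂) ω') u o} *
          (avoidAll ends a₂ {u}).indicator 1 ω)
        = ({W : Set V | c ∈ W}).indicator 1 (cluster ends ω a₂) *
          (prob p {ω' | Conn ends (delConfig ends (cluster ends ω a₂) ω') u o} *
            prob p (connEvent ends u b)) *
          (avoidAll ends a₂ {u}).indicator 1 ω := by ring
      _ ≤ ({W : Set V | c ∈ W}).indicator 1 (cluster ends ω a₂) *
          prob p ({ω' | Conn ends (delConfig ends (cluster ends ω a₂) ω') u o} ∩
            {ω' | Conn ends (delConfig ends (cluster ends ω a₂) ω') u b}) *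
          (avoidAll ends a₂ {u}).indicator 1 ω :=
          mul_le_mul_of_nonneg_right (mul_le_mul_of_nonneg_left key h2) h3
  · simp only [Set.indicator_of_notMem hω, mul_zero, le_refl]

/-- **The `o ∈ L` half on the class** (an identity once the `b ∈ K` masses vanish and the `b`-side
factorises). -/
theorem T2oL_sepUB_eq (hsep : ∀ ω : Config E, Conn ends ω a₂ b → Conn ends ω a₂ u) (hua : u ≠ a₂) :
    T2oL p ends o a₂ c b u =
      2 * prob p (connEvent ends u b) *
          ((2 - prob p (avoidAll ends a₂ {u})) * (prob p (PDEvent ends u a₂ c) + prob p (TEvent ends a₂ u c)) -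
            prob p (avoidAll ends a₂ {u}) * prob p (avoidAll ends a₂ {c})) *
          prob p (PDEvent ends u a₂ c ∩ connEvent ends u o) +
        2 * prob p (connEvent ends u b) *
          (prob p (PDEvent ends u a₂ c) * (1 - prob p (avoidAll ends a₂ {u})) -
            prob p (avoidAll ends a₂ {c}) * prob p (avoidAll ends a₂ {u})) *
          prob p (TEvent ends u a₂ c ∩ connEvent ends u o) +
        2 * (prob p (PDEvent ends u a₂ c) + prob p (avoidAll ends a₂ {c}) * prob p (avoidAll ends a₂ {u})) *
          prob p (TEvent ends u a₂ c ∩ (connEvent ends u o ∩ connEvent ends u b)) := by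
  have hgap := gap_eq_Q p ends u a₂ b
  have hbL := Qsplit p ends u a₂ c (connEvent ends u b)
  have hZ := Qsplit_univ p ends u a₂ c
  have z1 : prob p (avoidAll ends a₂ {u} ∩ connEvent ends a₂ b) = 0 :=
    prob_eq_zero_of_subset p ends a₂ b u hsep le_rfl
  have z2 : prob p (TEvent ends a₂ u c ∩ connEvent ends a₂ b) = 0 :=
    prob_eq_zero_of_subset p ends a₂ b u hsep
      (Set.inter_subset_inter_left _ (SepB.TEvent_swap_subset ends a₂ c u))
  have z3 : prob p (TEvent ends u a₂ c ∩ connEvent ends a₂ b) = 0 :=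
    prob_eq_zero_of_subset p ends a₂ b u hsep
      (Set.inter_subset_inter_left _ (SepB.TEvent_subset ends a₂ c u))
  have z4 : prob p (PDEvent ends u a₂ c ∩ connEvent ends a₂ b) = 0 :=
    prob_eq_zero_of_subset p ends a₂ b u hsep
      (Set.inter_subset_inter_left _ (SepB.PDEvent_subset ends a₂ c u))
  have z5 : prob p (PDEvent ends u a₂ c ∩ (connEvent ends u o ∩ connEvent ends a₂ b)) = 0 :=
    prob_eq_zero_of_subset p ends a₂ b u hsep
      (fun ω hω => ⟨SepB.PDEvent_subset ends a₂ c u hω.1, hω.2.2⟩)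
  have z6 : prob p (TEvent ends u a₂ c ∩ (connEvent ends u o ∩ connEvent ends a₂ b)) = 0 :=
    prob_eq_zero_of_subset p ends a₂ b u hsep
      (fun ω hω => ⟨SepB.TEvent_subset ends a₂ c u hω.1, hω.2.2⟩)
  have hQbL := prob_Q_bL_eq p ends a₂ b u hsep hua
  have hTbL := prob_T_bL_eq p ends a₂ c b u hsep hua
  have hhb := hb_eq p ends a₂ b u hsep hua
  have hTpbL : prob p (TEvent ends a₂ u c ∩ connEvent ends u b) =
      prob p (connEvent ends u b) * prob p (avoidAll ends a₂ {u}) -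
        prob p (connEvent ends u b) * prob p (TEvent ends u a₂ c) -
        prob p (PDEvent ends u a₂ c ∩ connEvent ends u b) := by
    rw [← hQbL, ← hTbL]
    linarith
  unfold T2oL EQb3 PDb EQ3
  rw [prob_univ, hgap, z1, z2, z3, z4, z5, z6, hQbL, hTbL, hhb, hTpbL, hZ]
  ring

omit [Fintype V] in
/-- Harris for the two decreasing events `Q` and `{a₂ ↮ c}`: `d0 · Z ≤ P(Q, a₂ ↮ c) = D + t′`. -/
lemma d0_mul_Z_le (hp : IsProbVec p) :
    prob p (avoidAll ends a₂ {c}) * prob p (avoidAll ends a₂ {u}) ≤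
      prob p (PDEvent ends u a₂ c) + prob p (TEvent ends a₂ u c) := by
  have hQ : IsLowerSet (avoidAll ends a₂ {u}) := by
    rw [avoidAll_singleton_eq ends]
    exact (isUpperSet_connEvent ends a₂ u).compl
  have hC : IsLowerSet (avoidAll ends a₂ {c}) := by
    rw [avoidAll_singleton_eq ends]
    exact (isUpperSet_connEvent ends a₂ c).compl
  have h := prob_mul_prob_le_prob_inter_of_isLowerSet hp hC hQ
  have hsplit := Qsplit p ends u a₂ c (avoidAll ends a₂ {c})
  have e1 : PDEvent ends u a₂ c ∩ avoidAll ends a₂ {c} = PDEvent ends u a₂ c := by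
    ext ω
    simp only [Set.mem_inter_iff, PDEvent, Dtilde, inU, Set.mem_compl_iff, Set.mem_union,
      mem_connEvent, avoidAll, Set.mem_setOf_eq, Finset.mem_singleton, forall_eq, not_or]
    constructor
    · rintro ⟨h, _⟩; exact h
    · rintro ⟨h1, h2, h3⟩; exact ⟨⟨h1, h2, h3⟩, fun h => h3 (conn_symm h)⟩
  have e2 : TEvent ends u a₂ c ∩ avoidAll ends a₂ {c} = ∅ := by
    ext ω
    simp only [Set.mem_inter_iff, TEvent, Set.mem_compl_iff, mem_connEvent, avoidAll,
      Set.mem_setOf_eq, Finset.mem_singleton, forall_eq, Set.mem_empty_iff_false, iff_false, not_and]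
    exact fun h1 h2 => h2 h1.2
  have e3 : TEvent ends a₂ u c ∩ avoidAll ends a₂ {c} = TEvent ends a₂ u c := by
    ext ω
    simp only [Set.mem_inter_iff, TEvent, Set.mem_compl_iff, mem_connEvent, avoidAll,
      Set.mem_setOf_eq, Finset.mem_singleton, forall_eq]
    constructor
    · rintro ⟨h, _⟩; exact h
    · rintro ⟨h1, h2⟩; exact ⟨⟨h1, h2⟩, fun h => h1 (conn_trans h2 (conn_symm h))⟩
  rw [e1, e2, e3, prob_empty] at hsplit
  rw [Set.inter_comm] at h
  linarith

/-- **The `o ∈ L` half is non-negative on the class.** -/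
theorem T2oL_nonneg_of_sepUB (hp : IsProbVec p)
    (hsep : ∀ ω : Config E, Conn ends ω a₂ b → Conn ends ω a₂ u) (hua : u ≠ a₂) :
    0 ≤ T2oL p ends o a₂ c b u := by
  rw [T2oL_sepUB_eq p ends o a₂ c b u hsep hua]
  have hH := prob_T_oL_bL_ge p ends o a₂ c b u hp hsep hua
  have hd := d0_mul_Z_le p ends a₂ c u hp
  set pb := prob p (connEvent ends u b) with hpb
  set Z := prob p (avoidAll ends a₂ {u}) with hZ
  set D := prob p (PDEvent ends u a₂ c) with hD
  set tp := prob p (TEvent ends a₂ u c) with htp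
  set d0 := prob p (avoidAll ends a₂ {c}) with hd0
  set Y := prob p (PDEvent ends u a₂ c ∩ connEvent ends u o) with hY
  set W := prob p (TEvent ends u a₂ c ∩ connEvent ends u o) with hW
  set W2 := prob p (TEvent ends u a₂ c ∩ (connEvent ends u o ∩ connEvent ends u b)) with hW2
  have hpb0 : 0 ≤ pb := prob_nonneg hp _
  have hZ0 : 0 ≤ Z := prob_nonneg hp _
  have hZ1 : Z ≤ 1 := prob_le_one hp _
  have hD0 : 0 ≤ D := prob_nonneg hp _
  have hd00 : 0 ≤ d0 := prob_nonneg hp _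
  have hY0 : 0 ≤ Y := prob_nonneg hp _
  have hW0 : 0 ≤ W := prob_nonneg hp _
  -- `α + κ ≥ 0`: `(2 − Z)(D + t′) − Z d0 ≥ (2 − Z) Z d0 − Z d0 = Z d0 (1 − Z) ≥ 0`
  have hak : 0 ≤ (2 - Z) * (D + tp) - Z * d0 := by nlinarith [mul_nonneg (mul_nonneg hZ0 hd00) (sub_nonneg.2 hZ1)]
  -- `β ≥ 0` and `α + β pb = pb D (2 − Z) ≥ 0`
  have hβ : 0 ≤ D + d0 * Z := add_nonneg hD0 (mul_nonneg hd00 hZ0)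
  have h1 : 0 ≤ 2 * pb * ((2 - Z) * (D + tp) - Z * d0) * Y :=
    mul_nonneg (mul_nonneg (mul_nonneg (by norm_num) hpb0) hak) hY0
  have h2 : 2 * (D + d0 * Z) * (pb * W) ≤ 2 * (D + d0 * Z) * W2 :=
    mul_le_mul_of_nonneg_left hH (mul_nonneg (by norm_num) hβ)
  have h3 : 0 ≤ 2 * pb * (D * (2 - Z)) * W :=
    mul_nonneg (mul_nonneg (mul_nonneg (by norm_num) hpb0) (mul_nonneg hD0 (by linarith))) hW0
  nlinarith [h1, h2, h3]

end SepUB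

end SepUB

end RootLeafU

end Summit.Ventures.PercRepro2
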